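import Mathlib
import Literature.MathematicalPhysics.QuantumFieldTheory.Balaban1983to89.B11Prop6Scheme
import Literature.MathematicalPhysics.QuantumFieldTheory.Balaban1983to89.T4R1Response
import Literature.MathematicalPhysics.QuantumFieldTheory.Balaban1983to89.T4EtaRateMin

/-!
# T4FixedPointResponse — Lipschitz response of Bałaban's variational fixed point (Sect. E, (116)–(121), Prop. 6) in its data, the nesting identity and the ONE-STEP re-cut of the η-rate of the minimisers (cell `pub-balaban`, T4-DAG node U1b, NEW ESTIMATE NE3, prover seat P1 = implicit-function / contraction-mapping route; bookkeeping + typed gap)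

HONEST FRAMING (cell `pub-balaban`, T4-DAG PAGE 1).  The cell's T4 target is the existence AND uniqueness of the
ε → 0 limit of Bałaban's unit-scale averaged expectations on a FIXED finite torus T⁴ — rung (B)+1 of the cell's
ladder, a constructive-QFT statement strictly beyond ultraviolet stability; it is NOT infinite volume, NOT the
Yang–Mills mass gap and NOT the Clay problem.  This module serves the sub-node U1b (NEW ESTIMATE NE3, "η-rate of the
minimisers": successive minimal configurations U_k(V), U_{k+1}(V) of (5) p. 278 at spacings η = L^{−k}, η/L read at
a common unit-scale site differ by ≤ Cθ^k, typed as `T4EtaRateMin.LocalRate`).  EVERYTHING below is kernel-checked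
mathematics over ABSTRACT normed spaces and order structures: §§1–5 are corollaries of the contraction scheme
(116)–(121) exactly as typed in the tree (`B11Prop6Scheme.mapT 𝒢 Λ W J 𝔄 X = −𝒢 J + Λ (X + 𝔄) − 𝒢 (W (X + 𝔄))`),
§6 is an order-theoretic identity about nested constrained minima, §7 is linear algebra of first-order conditions,
§8 is the assembly into NE3's bookkeeping with EVERY non-printed input a named binder.  The module asserts NOTHING
about Bałaban's lattices, minimisers, Green's functions or norms: where a docstring says "intended: …" it records the
dictionary of the record HOME/t4/T4-EST-NE3-P1.md (this seat), never a fact.  No internally-minted statement enters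
as a cited fact; the manuscripts under audit are quoted for what they STATE.  Conditionals of the cell (BetaPertH,
(B), (B^μ)) do NOT occur: NE3 concerns minimisers only (T4-DAG §3; HOME/t4/T4-EST-U1b.md §0).  Value = kernel
certificate of the perturbation lemmas the printed scheme implies but does not state + the typed form of the exact
missing inequality (OSC below); NOT a proof of NE3, NOT summit progress.

PRINTED CONTEXT.  [R] = read by this seat on the RENDERED journal pages of T. Bałaban, *Averaging operations for
lattice gauge theories II / The variational problem …*, Commun. Math. Phys. 102 (1985) 277–309 = [Balaban1985Variational]
(renders `b2b-balaban-ref1/pages/1985-cmp102-variational-background/…-p002/p003/p004-x2.png`, page = PDF + 276);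
[tree pointer] = quoted from the cite-tagged docstrings of the tree modules `B11Prop6Scheme` (b11-g10) and
`T4R1Response` (pv21-g3), whose seats read pp. 293–296 on renders — not re-rendered here.
* p. 278 [R]: the small-field conditions "(2)" «|U(∂p) − 1| = |(∂U)(p) − 1| < ε₀L^{−2j} = ε₀η²(L^jη)^{−2} for
  p ∈ Ω_j, j = 0, 1, …, k, |(D*_U∂U)(b)| < ε₀L^{−2j}(L^jη)^{−1} = ε₀η²(L^jη)^{−3} for b ∈ Ω_j, (2)» (v1.1: the full
  display restored — v1 elided the middle member and the current clause; XREAD C-pv01-68 A1); the constraints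
  "(3)" «Ū^j = V on Λ_j»; the action "(5)" «A(U) = A^η(U) = Σ_{p⊂Ω₀} η^{d−4}[1 − Re tr U(∂p)], η = L^{−k}»;
  the data class "(7)" «|(∂V)(p′) − 1| < ε₁»; and «for ε₀ sufficiently small there is at most one critical orbit».
* p. 279 [R]: Theorem 1 — the critical orbit lies in «𝔘_k({Ω_j}, B₃ε₁) ∩ 𝔅_k(𝔅_k, V)» "(8)", «This orbit is a unique
  critical orbit in the space (6) if B₃ε₁ ≤ ε₀ and ε₀ ≤ a₀», with the regularity bounds (9)–(10); «Minimal
  configurations will be denoted by U_k(V)»; «we will prove that they are analytic functions of V»; the crude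
  refinement "(11)" «V₀ = V on ∪_{j=0}^{k−1} Λ_j, V̄₀ = V on Λ_k. (11) For example we can take V_{0,b} = V_{b′}, for
  b ∈ B(b′), b′ ∈ Λ_k and V_{0,b} = 1 for remaining bonds of B(Λ_k).» (v1.1: union limits and punctuation restored;
  XREAD C-pv01-68 A2).
* p. 280 [R]: the inductive background «U₀ = U_{k−1}(V₀)» "(12)", «U₀ ∈ 𝔘_k({Ω_j}, B₃L³ε₁) ∩ 𝔅_k(𝔅_k, V)» "(13)",
  «hence U₀ should be close to the minimal configuration we are looking for»; the background class "(14)"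
  «U₀ ∈ 𝔘_k({Ω_j}, C₁B₃ε₁), |Ū₀^j − V| < C₁ε₁ on Λ_j» and «The configuration U₀ constructed above satisfies (14) with
  C₁ = L³»; the parametrisation (15)–(18) of U around U₀ (U′ = e^{iηA′}, gauge condition, constraint B).
* p. 282 [tree pointer, `T4R1Response`]: «J = D*η^{−2} Im ∂U₀ = Im η^{−2}D*∂U₀, |J| < C₁B₃ε₁(L^jη)^{−3} on Ω_j, (28) the
  bound holds by the assumption (14).»
* pp. 293–296 [tree pointer, `B11Prop6Scheme`, `T4R1Response`]: Prop. 4 "(98)" «|((δ/δA′)V)(A′)|_(−3) ≤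
  C₄(max{|A′|_(−1), |∇A′|_(−2)})²» valid for norm ≤ a₃; "(103)" the bound on H₁B; Eq. "(111)" «A₁ + 𝔊J +
  𝔊((δ/δA′)V)(A₁ + H₁B) = 0»; the space "(115)" «max{|A₁|_(−1), |∇A₁|_(−2)} < ε₄»; the map "(116)" «A₁ → −𝔊J −
  𝔊((δ/δA′)V)(A₁ + H₁B)»; "(117)" «B₀|J|_(−3) + B₀|((δ/δA′)V)(A₁ + H₁B)|_(−3) < B₀C₁B₃ε₁ + B₀C₄(ε₄ + B₀|B|)²» («By
  Theorem 3.13 of [5]»); the Lipschitz estimate "(119)–(120)" with constant 4B₀C₄(ε₄ + B₀|B|) under «2(ε₄ + B₀|B|) ≤ a₃»;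
  the contraction conditions "(121)"; «Proposition 6. There exists a positive, absolute constant a₄ such, that for
  ε₄ ≤ a₄ and ε₁ satisfying 2B₀C₁B₃ε₁ ≤ ε₄ Eq. (111) has exactly one solution in the space (115). This solution
  satisfies the bounds (115) with ε₄ = 3B₀C₁B₃ε₁.»  [cite: Balaban1985Variational, (2)–(18) pp. 278–280, (28) p. 282,
  (98) p. 293, (111)–(121) and Prop. 6 pp. 294–296]
* PUBLISHED MODEL of an η-rate (outside the audited series; cell CITED-FACTS F-T6, S-t4lit12-5): C. King, Commun.
  Math. Phys. 102 (1986) 649–677 = [King1986], Lemma 4.4 "(4.29)" and Lemma 4.5 "(4.38)" «|C^{(k)}(x, y) −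
  C^{(k+n)}(x, y)| ≤ CL^{−k}e^{−δ₀|x−y|}» (scalar, A = 0, d = 2, 3); Glimm–Jaffe, *Quantum Physics* (2nd ed. 1987)
  §9.5 "(9.5.25)" «0 ≤ k² − λ_k^δ ≤ … ≤ O(1)|k|⁴δ²» (symbol comparison of lattice Laplacians).  Quoted as the printed
  TEMPLATE of the linear layer of OSC, never as a hypothesis of a declaration here.

WHAT IS NOT PRINTED (located absences; HOME/t4/T4-XREAD-U1b-L3.md §0, §3 null greps «Lipschitz», «response»,
«η-rate» in CMP 102; HOME/t4/T4-EST-U1b.md §3′).  (a) The LIPSCHITZ dependence of the Prop. 6 solution on its data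
(J, H₁B) and on the background (through 𝔊(U₀), 𝔊QH, (δ/δA′)V) — §§4–5 here.  (b) The RESIDUAL-SEPARATED a-priori
radius ‖A₁‖ ≤ 2‖𝔊J‖ (exact constraints) — §3 here (`T4R1Response` derived 7‖A₁‖ ≤ 8‖𝔊J‖ + ‖H₁B‖ from the
displayed (117), (121) as arithmetic; here it is a theorem of the typed scheme).  (c) Any comparison of the
minimisers U_k(V), U_{k+1}(V) at two spacings, with or without rate (NE3 itself; T4-DAG §6 «not printed»).  (d) The
one-step classical-correction estimate OSC (below) — the exact missing inequality of this route.

WHAT IS PROVED HERE (sorry-free; every theorem an implication over abstract carriers; tags [folklore] = standard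
analysis the kernel re-derives, [cite: …] = the printed display whose abstract form is USED AS A HYPOTHESIS SHAPE).
§1 `norm_sub_le_of_fixedPoints` (two maps on one ball: ‖X₁ − X₂‖ ≤ ‖T₁X₂ − T₂X₂‖/(1 − q)), `norm_le_of_fixedPoint`.
§2 `quadAnalytic_norm_sub_le`: the (119)–(120) Lipschitz constant 4C₄m of a `B13Contraction113.QuadAnalytic W C₄ a₃`
map on the ball of radius m, 2m ≤ a₃ (Cauchy step of [Balaban1985Variational] p. 295, via `norm_sub_le_of_sphere_bound`).
§3 one datum (R1^ϱ as THEOREMS of the scheme): `norm_mapT_zero_le` (‖T0‖ ≤ ‖𝒢J‖ + ‖Λ𝔄‖ + B₀C₄‖𝔄‖²),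
`norm_solution_le_defect`, `norm_solution_le_two` (contraction factor ≤ ½ ⇒ ‖X‖ ≤ 2‖𝒢J‖ + 2‖Λ𝔄‖ + 2B₀C₄‖𝔄‖²),
`norm_solution_le_two_exact` (𝔄 = 0, Λ = 0: ‖X‖ ≤ 2‖𝒢 J‖), `ineq117_at_fixedPoint`, `seven_norm_solution_le`
(the `T4R1Response.apriori_response` corollary 7‖X‖ ≤ 8‖𝒢J‖ + ‖𝔄‖ re-derived from the scheme).
§4 two data, one background: `mapT_sub_mapT_data`, `norm_defect_data_le`, `norm_solution_sub_le_data`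
(‖X₁ − X₂‖ ≤ (‖𝒢(J₁ − J₂)‖ + q‖𝔄₁ − 𝔄₂‖)/(1 − q), q = θ + 4B₀C₄(ε₄ + a)).
§5 two backgrounds: `mapT_sub_mapT_background`, `norm_solution_sub_le_general`, `norm_solution_sub_le_background`
(‖X₁ − X₂‖ ≤ (‖(𝒢₁ − 𝒢₂)J‖ + ‖(Λ₁ − Λ₂)(X₂ + 𝔄)‖ + ‖(𝒢₁ − 𝒢₂)(W₂(X₂ + 𝔄))‖ + B₀‖W₁(X₂ + 𝔄) − W₂(X₂ + 𝔄)‖)/(1 − q₁)).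
§6 nesting: `effAction S Q₁ A V₀ := sInf (A '' {U ∈ S | Q₁ U = V₀})` (the one-step EFFECTIVE action = classical part
of one renormalisation step) and `effAction_avg_eq`, `effAction_avg_le`, `min_in_fibre`: if Us minimises A on S under
the composite constraint Qk (Q₁ U) = V, then Q₁ Us minimises `effAction S Q₁ A` under Qk · = V and Us minimises A in
its own Q₁-fibre (NEST: W_k(V) := Q₁U_{k+1}(V) is the minimiser of the one-step effective action under the SAME k-fold
constraint on the SAME lattice T_η on which U_k(V) minimises the bare action (5); U_{k+1}(V) = U₁(W_k(V))).
§7 first-order transfer: `propagated_residual_eq` (𝒢∘𝔓 = 𝒢, J = Jeff − Jδ, 𝔓 Jeff = 0 ⇒ 𝒢 J = −𝒢 Jδ),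
`norm_propagated_residual_eq`, `norm_solution_le_two_oneStep` (‖X‖ ≤ 2‖𝒢 Jδ‖: the response of U_k(V) around
W_k(V) is at most twice the PROPAGATED DERIVATIVE OF THE ONE-STEP CLASSICAL CORRECTION δA := effective − bare at W).
§8 `OneStepCorrectionRate` (the shape of OSC) and `localRate_of_oneStep` / `localRate_of_oneStep'`: NE3's
`LocalRate R (Λr·Γ·ρ₁ + ρ₂) θ` from the named binders hread (R3-type Lipschitz reading + pairing defect), hresp
(R0 ∧ R1^ϱ ∧ ENV ∧ PROJ per instance, Γ = 2), hosc (OSC), hpair (pairing rate).  §9 non-vacuity instances.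

DICTIONARY TO NE3 AND THE WALL (record HOME/t4/T4-EST-NE3-P1.md §§3–4; [analysis] of this seat, NOT printed, NOT
asserted by any declaration).  Per run k ≥ 1 and datum V in class (7): W := W_k(V) = Q₁U_{k+1}(V) ∈ class (14) with
B = 0 exactly (R0, printed-type via (13)); U_k(V) = W^{gauge}e^{iηA₁} with A₁ the Prop. 6 fixed point around U₀ = W
(R1^ϱ: ‖A₁‖_(115) ≤ 2ϱ_k(V), ϱ_k(V) := ‖𝔊(W)J(W)‖_(115), kernel §3); NEST + ENV (the one-step effective action is
differentiable at the interior constrained minimiser W: printed-type, Theorem 1 + Sect. G analyticity applied to the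
ONE-STEP problem, whose hypotheses B₃ε₁′ ≤ ε₀′ rescale consistently, ε₁′ = cε₁η², ε₀′ = ε₀η²) + PROJ (𝔊𝔓 = 𝔊) give
ϱ_k(V) = osc_k(V) := ‖𝔊(W) 𝔓 D(δA_k)(W)‖_(115), δA_k := effAction − A^η (kernel §7).  THE WALL = OSC:
«∃ ρ, θ < 1: ∀ k ≥ 1, ∀ V ∈ (7): osc_k(V) ≤ ρθ^k» — NOT PRINTED ((28) bounds the bare and effective currents by the
regularity radius C₁B₃ε₁ SEPARATELY, with no cancellation and no slow-variation gain; Bałaban's data class (7) carries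
no smoothness, so no printed statement exhibits the two extra derivatives).  Linear (abelian, A = 0) layer: D(δA) =
(Δ₁^{eff} − Δ)·(background potential) with symbol κ_L p⁴ + O(p⁶), κ_L = (L² − 1)/(6L²) for block means (this seat's
toy, record §4.3; printed templates: [King1986] (4.7), (4.29), Glimm–Jaffe (9.5.25)), whence osc ~ η at the gradient
level through the face layers of the block lattice: predicted θ = L^{−1} with NO room at the gradient level,
consistent with the EST seat's linearised toy (HOME/t4/T4-RUNG-U1b2.md: rates γ = 2, 1).  GAPS G-ne3p1-1…4.
-/

open Metric Set

namespace Literature.MathematicalPhysics.QuantumFieldTheory.Balaban1983to89.T4FixedPointResponse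

open Literature.MathematicalPhysics.QuantumFieldTheory.Balaban1983to89.B13Contraction113 (QuadAnalytic
  norm_sub_le_of_sphere_bound)
open Literature.MathematicalPhysics.QuantumFieldTheory.Balaban1983to89.B11Prop6Scheme

/-! ## §1 The fixed-point perturbation lemma (folklore; the quantitative half of the implicit-function /
contraction-mapping principle) -/

/-- **Fixed points of two maps on one ball.**  If `T₁` is `q`-Lipschitz (`q < 1`) on the closed ball of radius
`r`, `X₁` is a fixed point of `T₁` and `X₂` a fixed point of an ARBITRARY second map `T₂`, both in the ball, then
`‖X₁ − X₂‖ ≤ ‖T₁ X₂ − T₂ X₂‖ / (1 − q)`: the distance of the fixed points is controlled by the DEFECT of the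
second fixed point under the first map.  No completeness, existence or uniqueness is used. [folklore] -/
theorem norm_sub_le_of_fixedPoints {E : Type*} [NormedAddCommGroup E] {T₁ T₂ : E → E} {q r : ℝ}
    (hq : q < 1) (hT₁ : ∀ x y : E, ‖x‖ ≤ r → ‖y‖ ≤ r → ‖T₁ x - T₁ y‖ ≤ q * ‖x - y‖)
    {X₁ X₂ : E} (h₁ : ‖X₁‖ ≤ r) (h₂ : ‖X₂‖ ≤ r) (f₁ : T₁ X₁ = X₁) (f₂ : T₂ X₂ = X₂) :
    ‖X₁ - X₂‖ ≤ ‖T₁ X₂ - T₂ X₂‖ / (1 - q) := by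
  have h1q : 0 < 1 - q := by linarith
  rw [le_div_iff₀ h1q]
  have key : ‖X₁ - X₂‖ ≤ q * ‖X₁ - X₂‖ + ‖T₁ X₂ - T₂ X₂‖ := by
    have hsplit : X₁ - X₂ = (T₁ X₁ - T₁ X₂) + (T₁ X₂ - T₂ X₂) := by
      conv_lhs => rw [← f₁, ← f₂]
      abel
    calc ‖X₁ - X₂‖ = ‖(T₁ X₁ - T₁ X₂) + (T₁ X₂ - T₂ X₂)‖ := by rw [← hsplit]
      _ ≤ ‖T₁ X₁ - T₁ X₂‖ + ‖T₁ X₂ - T₂ X₂‖ := norm_add_le _ _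
      _ ≤ q * ‖X₁ - X₂‖ + ‖T₁ X₂ - T₂ X₂‖ := by
          gcongr
          exact hT₁ X₁ X₂ h₁ h₂
  have e : ‖X₁ - X₂‖ * (1 - q) = ‖X₁ - X₂‖ - q * ‖X₁ - X₂‖ := by ring
  rw [e]
  linarith

/-- **One map: the a-priori bound by the defect of the origin.**  If `T` is `q`-Lipschitz (`q < 1`) on the closed
ball of radius `r ≥ 0` and `X` is a fixed point of `T` in the ball, then `‖X‖ ≤ ‖T 0‖ / (1 − q)`. [folklore] -/
theorem norm_le_of_fixedPoint {E : Type*} [NormedAddCommGroup E] {T : E → E} {q r : ℝ} (hq : q < 1)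
    (hr : 0 ≤ r) (hT : ∀ x y : E, ‖x‖ ≤ r → ‖y‖ ≤ r → ‖T x - T y‖ ≤ q * ‖x - y‖) {X : E}
    (hX : ‖X‖ ≤ r) (f : T X = X) : ‖X‖ ≤ ‖T 0‖ / (1 - q) := by
  have h := norm_sub_le_of_fixedPoints (T₂ := fun _ : E => (0 : E)) hq hT hX
    (by simpa using hr) f rfl
  simpa using h

/-! ## §2 The Lipschitz bound of the quadratic-analytic part on a ball (the Cauchy-formula step (119)–(120),
re-cut for two arbitrary points) -/

variable {𝒴 𝒵 : Type*} [NormedAddCommGroup 𝒴] [NormedSpace ℂ 𝒴] [NormedAddCommGroup 𝒵] [NormedSpace ℂ 𝒵]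
variable {𝒢 : 𝒵 →L[ℂ] 𝒴} {Λ : 𝒴 →L[ℂ] 𝒴} {W : 𝒴 → 𝒵} {B₀ θ C₄ a₃ : ℝ}

/-- **(119)–(120) for two points of the open ball of radius `m`, `2m ≤ a₃`.**  For `W` quadratic-analytic
(`QuadAnalytic W C₄ a₃`: ‖W Y‖ ≤ C₄‖Y‖² on ‖Y‖ < a₃ and holomorphy along complex lines — Prop. 4 (98) as a
hypothesis structure) and ‖P₁‖, ‖P₂‖ < m: `‖W P₁ − W P₂‖ ≤ 4 C₄ m ‖P₁ − P₂‖`.  Same Cauchy-estimate argument as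
`B11Prop6Scheme.lipschitz_120` (segment in the ball of radius m, discs of radius r = m‖P₁ − P₂‖⁻¹ in the ball of
radius 2m ≤ a₃, sphere bound C₄(2m)², `B13Contraction113.norm_sub_le_of_sphere_bound`), stated for arbitrary
P₁, P₂ so that it also serves differences in the DATA 𝔄 (two-data response, §4).
[cite: Balaban1985Variational, (119)-(120) p.295] -/
theorem quadAnalytic_norm_sub_le (hW : QuadAnalytic W C₄ a₃) (hC₄ : 0 ≤ C₄) {m : ℝ} (hdom : 2 * m ≤ a₃)
    {P₁ P₂ : 𝒴} (hP₁ : ‖P₁‖ < m) (hP₂ : ‖P₂‖ < m) : ‖W P₁ - W P₂‖ ≤ 4 * C₄ * m * ‖P₁ - P₂‖ := by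
  have hmpos : 0 < m := (norm_nonneg _).trans_lt hP₁
  set Q : 𝒴 := P₁ - P₂ with hQ
  set h : ℂ → 𝒵 := fun ζ => W (P₂ + ζ • Q) with hh
  have h0 : h 0 = W P₂ := by simp [hh]
  have h1 : h 1 = W P₁ := by
    simp only [hh, hQ, one_smul]
    congr 1
    abel
  by_cases hQ0 : ‖Q‖ = 0
  · have hx : P₁ = P₂ := sub_eq_zero.mp (norm_eq_zero.mp hQ0)
    have h0' : W P₁ - W P₂ = 0 := by rw [hx, sub_self]
    rw [h0', hQ0]; simp
  have hQpos : 0 < ‖Q‖ := lt_of_le_of_ne (norm_nonneg _) (Ne.symm hQ0)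
  set r : ℝ := m / ‖Q‖ with hr
  have hrpos : 0 < r := div_pos hmpos hQpos
  have hrQ : r * ‖Q‖ = m := by rw [hr, div_mul_cancel₀ _ (ne_of_gt hQpos)]
  -- the points of the segment lie in the open ball of radius m
  have hseg : ∀ t : ℝ, t ∈ Icc (0:ℝ) 1 → ‖P₂ + (t : ℂ) • Q‖ < m := by
    intro t ht
    have hconv := (convex_ball (0:𝒴) m) (mem_ball_zero_iff.2 hP₂) (mem_ball_zero_iff.2 hP₁)
      (sub_nonneg.mpr ht.2) ht.1 (by ring)
    have heq : (1 - t) • P₂ + t • P₁ = P₂ + (t : ℂ) • Q := by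
      rw [hQ, Complex.coe_smul, smul_sub, sub_smul, one_smul]
      abel
    rw [heq, mem_ball_zero_iff] at hconv
    exact hconv
  -- the discs of radius r around the segment lie in the ball of radius 2m ≤ a₃
  have hdisc : ∀ t : ℝ, t ∈ Icc (0:ℝ) 1 → ∀ z ∈ closedBall (t : ℂ) r, ‖P₂ + z • Q‖ < 2 * m := by
    intro t ht z hz
    rw [mem_closedBall, dist_eq_norm] at hz
    have hsplit : P₂ + z • Q = (P₂ + (t : ℂ) • Q) + (z - t) • Q := by rw [sub_smul]; abel
    calc ‖P₂ + z • Q‖ = ‖(P₂ + (t : ℂ) • Q) + (z - t) • Q‖ := by rw [hsplit]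
      _ ≤ ‖P₂ + (t : ℂ) • Q‖ + ‖(z - t) • Q‖ := norm_add_le _ _
      _ = ‖P₂ + (t : ℂ) • Q‖ + ‖z - (t : ℂ)‖ * ‖Q‖ := by rw [norm_smul]
      _ ≤ ‖P₂ + (t : ℂ) • Q‖ + r * ‖Q‖ := by gcongr
      _ < m + m := add_lt_add_of_lt_of_le (hseg t ht) hrQ.le
      _ = 2 * m := by ring
  have hU : IsOpen {ζ : ℂ | ‖P₂ + ζ • Q‖ < a₃} :=
    isOpen_lt (continuous_const.add (continuous_id.smul continuous_const)).norm continuous_const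
  have hsub : ∀ t : ℝ, t ∈ Icc (0:ℝ) 1 → closedBall (t : ℂ) r ⊆ {ζ : ℂ | ‖P₂ + ζ • Q‖ < a₃} :=
    fun t ht z hz => (hdisc t ht z hz).trans_le hdom
  have hM : ∀ t : ℝ, t ∈ Icc (0:ℝ) 1 → ∀ z ∈ sphere (t : ℂ) r, ‖h z‖ ≤ C₄ * (2 * m) ^ 2 := by
    intro t ht z hz
    have hlt := hdisc t ht z (sphere_subset_closedBall hz)
    calc ‖h z‖ = ‖W (P₂ + z • Q)‖ := rfl
      _ ≤ C₄ * ‖P₂ + z • Q‖ ^ 2 := hW.quad _ (hlt.trans_le hdom)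
      _ ≤ C₄ * (2 * m) ^ 2 := mul_le_mul_of_nonneg_left (pow_le_pow_left₀ (norm_nonneg _) hlt.le 2) hC₄
  have main : ‖h 1 - h 0‖ ≤ C₄ * (2 * m) ^ 2 / r :=
    norm_sub_le_of_sphere_bound hU (hW.lineAnalytic P₂ Q) hrpos hsub hM
  rw [h1, h0] at main
  calc ‖W P₁ - W P₂‖ ≤ C₄ * (2 * m) ^ 2 / r := main
    _ = 4 * C₄ * m * ‖Q‖ := by
        rw [hr]
        field_simp
        ring

/-! ## §3 One datum: the response bound R1^ϱ as a THEOREM of the scheme (116)–(121) — the residual read through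
the propagator (ϱ = ‖𝔊J‖) and separated from the regularity radius -/

/-- The defect of the origin: `T 0 = −𝒢J + Λ𝔄 − 𝒢(W 𝔄)`, so `‖T 0‖ ≤ ‖𝒢 J‖ + ‖Λ 𝔄‖ + B₀C₄‖𝔄‖²` whenever
‖𝔄‖ < a₃ (‖𝒢 f‖ ≤ B₀‖f‖ is "Theorem 3.13 of [5]" as a hypothesis; ‖W Y‖ ≤ C₄‖Y‖² is Prop. 4 (98)).  The
residual J enters ONLY through the propagated datum 𝒢 J. [cite: Balaban1985Variational, (116)-(117) p.295] -/
theorem norm_mapT_zero_le (h𝒢 : ∀ f, ‖𝒢 f‖ ≤ B₀ * ‖f‖) (hW : QuadAnalytic W C₄ a₃) (hB₀ : 0 ≤ B₀)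
    (J : 𝒵) {𝔄 : 𝒴} (h𝔄 : ‖𝔄‖ < a₃) :
    ‖mapT 𝒢 Λ W J 𝔄 0‖ ≤ ‖𝒢 J‖ + ‖Λ 𝔄‖ + B₀ * C₄ * ‖𝔄‖ ^ 2 := by
  have h3 : ‖𝒢 (W 𝔄)‖ ≤ B₀ * C₄ * ‖𝔄‖ ^ 2 := by
    calc ‖𝒢 (W 𝔄)‖ ≤ B₀ * ‖W 𝔄‖ := h𝒢 _
      _ ≤ B₀ * (C₄ * ‖𝔄‖ ^ 2) := mul_le_mul_of_nonneg_left (hW.quad _ h𝔄) hB₀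
      _ = B₀ * C₄ * ‖𝔄‖ ^ 2 := by ring
  calc ‖mapT 𝒢 Λ W J 𝔄 0‖ = ‖(-𝒢 J + Λ 𝔄) - 𝒢 (W 𝔄)‖ := by simp [mapT]
    _ ≤ ‖-𝒢 J + Λ 𝔄‖ + ‖𝒢 (W 𝔄)‖ := norm_sub_le _ _
    _ ≤ (‖-𝒢 J‖ + ‖Λ 𝔄‖) + ‖𝒢 (W 𝔄)‖ := by gcongr; exact norm_add_le _ _
    _ = (‖𝒢 J‖ + ‖Λ 𝔄‖) + ‖𝒢 (W 𝔄)‖ := by rw [norm_neg]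
    _ ≤ ‖𝒢 J‖ + ‖Λ 𝔄‖ + B₀ * C₄ * ‖𝔄‖ ^ 2 := by linarith

/-- **R1^ϱ, defect form.**  Under the scheme's printed-type conditions (‖𝔄‖ < a, 2(ε₄ + a) ≤ a₃ — *«We have to
assume also that 2(ε₄ + B₀|B|) ≤ a₃»* — and the contraction constant q := θ + 4B₀C₄(ε₄ + a) < 1 of (120)–(121)),
EVERY fixed point X of (116)/(143) in the ball ‖X‖ ≤ ε₄ obeys
`‖X‖ ≤ (‖𝒢 J‖ + ‖Λ 𝔄‖ + B₀C₄‖𝔄‖²) / (1 − q)`.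
The residual enters through ‖𝒢J‖ (potential AND gradient level of the (115)-norm in the intended reading), the
constraint datum through 𝔄, and the REGULARITY RADIUS of (14) only through q and the thresholds — the
residual-separated response radius which is NOT printed (B11 prints const·C₁B₃ε₁, Prop. 6, because (28)
majorises |J|_{(−3)} by the regularity radius at once; census HOME/t4/T4-XREAD-U1b-L3.md §3).  A theorem of the
abstract scheme; whether Bałaban's objects realise the scheme is NOT asserted. [folklore] -/
theorem norm_solution_le_defect (h𝒢 : ∀ f, ‖𝒢 f‖ ≤ B₀ * ‖f‖) (hΛ : ∀ Y, ‖Λ Y‖ ≤ θ * ‖Y‖)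
    (hW : QuadAnalytic W C₄ a₃) (hB₀ : 0 ≤ B₀) (hC₄ : 0 ≤ C₄) {J : 𝒵} {𝔄 : 𝒴} {a ε₄ : ℝ}
    (h𝔄 : ‖𝔄‖ < a) (hε₄ : 0 ≤ ε₄) (hdom : 2 * (ε₄ + a) ≤ a₃)
    (hcontr : θ + 4 * B₀ * C₄ * (ε₄ + a) < 1) {X : 𝒴} (hX : ‖X‖ ≤ ε₄)
    (hfix : mapT 𝒢 Λ W J 𝔄 X = X) :
    ‖X‖ ≤ (‖𝒢 J‖ + ‖Λ 𝔄‖ + B₀ * C₄ * ‖𝔄‖ ^ 2) / (1 - (θ + 4 * B₀ * C₄ * (ε₄ + a))) := by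
  have ha : 0 < a := (norm_nonneg _).trans_lt h𝔄
  have h𝔄₃ : ‖𝔄‖ < a₃ := by linarith
  have h1 := norm_le_of_fixedPoint (T := mapT 𝒢 Λ W J 𝔄) hcontr hε₄
    (fun _ _ hx hy => lipschitz_120 (J := J) h𝒢 hΛ hW hB₀ hC₄ h𝔄 hε₄ hdom hx hy) hX hfix
  have h2 := norm_mapT_zero_le (Λ := Λ) h𝒢 hW hB₀ J h𝔄₃
  have h1q : 0 < 1 - (θ + 4 * B₀ * C₄ * (ε₄ + a)) := by linarith
  exact h1.trans (div_le_div_of_nonneg_right h2 h1q.le)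

/-- **R1^ϱ with the printed contraction constant ½** ((121): *«4B₀C₄(ε₄ + 2dLB₀C₁ε₁) ≤ ½»*, here θ-extended
q ≤ ½): `‖X‖ ≤ 2‖𝒢 J‖ + 2‖Λ 𝔄‖ + 2B₀C₄‖𝔄‖²` — response constant Γ = 2 against the propagated residual.
[cite: Balaban1985Variational, (121) p.295] -/
theorem norm_solution_le_two (h𝒢 : ∀ f, ‖𝒢 f‖ ≤ B₀ * ‖f‖) (hΛ : ∀ Y, ‖Λ Y‖ ≤ θ * ‖Y‖)
    (hW : QuadAnalytic W C₄ a₃) (hB₀ : 0 ≤ B₀) (hC₄ : 0 ≤ C₄) {J : 𝒵} {𝔄 : 𝒴} {a ε₄ : ℝ}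
    (h𝔄 : ‖𝔄‖ < a) (hε₄ : 0 ≤ ε₄) (hdom : 2 * (ε₄ + a) ≤ a₃)
    (hhalf : θ + 4 * B₀ * C₄ * (ε₄ + a) ≤ 1 / 2) {X : 𝒴} (hX : ‖X‖ ≤ ε₄)
    (hfix : mapT 𝒢 Λ W J 𝔄 X = X) :
    ‖X‖ ≤ 2 * ‖𝒢 J‖ + 2 * ‖Λ 𝔄‖ + 2 * (B₀ * C₄ * ‖𝔄‖ ^ 2) := by
  have h := norm_solution_le_defect h𝒢 hΛ hW hB₀ hC₄ h𝔄 hε₄ hdom (by linarith) hX hfix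
  set D : ℝ := ‖𝒢 J‖ + ‖Λ 𝔄‖ + B₀ * C₄ * ‖𝔄‖ ^ 2 with hD
  have hD0 : 0 ≤ D := by rw [hD]; positivity
  have h1q : (1 : ℝ) / 2 ≤ 1 - (θ + 4 * B₀ * C₄ * (ε₄ + a)) := by linarith
  have h' : D / (1 - (θ + 4 * B₀ * C₄ * (ε₄ + a))) ≤ D / (1 / 2) :=
    div_le_div_of_nonneg_left hD0 (by norm_num) h1q
  have : D / (1 / 2) = 2 * D := by ring
  linarith [h.trans h']

/-- **The NE3 instance: exact constraints and no linear term** (p. 299 *«Further, let us notice that B = 0»* for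
the background U₀ := U_k, so 𝔄 = H₁B = 0; (116) has no linear term): `‖X‖ ≤ 2‖𝒢 J‖` — the response of the
minimiser to the propagated residual ϱ = ‖𝔊J‖_{(115)} with Γ = 2, the form in which HOME/t4/T4-EST-U1b.md v2 §3′
(R1^ϱ) uses it ("[analysis, two lines]" there; kernel here, over the abstract scheme).
[cite: Balaban1985Variational, (116), (121) p.295; p.299] -/
theorem norm_solution_le_two_exact (h𝒢 : ∀ f, ‖𝒢 f‖ ≤ B₀ * ‖f‖) (hW : QuadAnalytic W C₄ a₃)
    (hB₀ : 0 ≤ B₀) (hC₄ : 0 ≤ C₄) {J : 𝒵} {a ε₄ : ℝ} (ha : 0 < a) (hε₄ : 0 ≤ ε₄)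
    (hdom : 2 * (ε₄ + a) ≤ a₃) (hhalf : 4 * B₀ * C₄ * (ε₄ + a) ≤ 1 / 2) {X : 𝒴} (hX : ‖X‖ ≤ ε₄)
    (hfix : mapT 𝒢 0 W J 0 X = X) : ‖X‖ ≤ 2 * ‖𝒢 J‖ := by
  have hΛ : ∀ Y : 𝒴, ‖(0 : 𝒴 →L[ℂ] 𝒴) Y‖ ≤ 0 * ‖Y‖ := fun Y => by simp
  have h𝔄 : ‖(0 : 𝒴)‖ < a := by simpa using ha
  have h := norm_solution_le_two h𝒢 hΛ hW hB₀ hC₄ h𝔄 hε₄ hdom (by linarith) hX hfix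
  simpa using h

/-- **(S1) of `T4R1Response` as a theorem of the scheme.**  At a fixed point X of (116) (no linear term) with
‖X + 𝔄‖ < a₃: `‖X‖ ≤ ‖𝒢 J‖ + B₀C₄(‖X‖ + ‖𝔄‖)²` — the shape `T4R1Response.Ineq117At` (x ≤ ϱ + K(x + b)², x the
(115)-norm of the solution, ϱ = ‖𝔊J‖, b ≥ ‖𝔄‖, K = B₀C₄), there a READING of (111) + (117), here discharged
over the Banach scheme. [cite: Balaban1985Variational, (111) p.294, (117) p.295] -/
theorem ineq117_at_fixedPoint (h𝒢 : ∀ f, ‖𝒢 f‖ ≤ B₀ * ‖f‖) (hW : QuadAnalytic W C₄ a₃) (hB₀ : 0 ≤ B₀)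
    (hC₄ : 0 ≤ C₄) {J : 𝒵} {𝔄 X : 𝒴} (harg : ‖X + 𝔄‖ < a₃) (hfix : mapT 𝒢 0 W J 𝔄 X = X) :
    ‖X‖ ≤ ‖𝒢 J‖ + B₀ * C₄ * (‖X‖ + ‖𝔄‖) ^ 2 := by
  have h3 : ‖𝒢 (W (X + 𝔄))‖ ≤ B₀ * C₄ * ‖X + 𝔄‖ ^ 2 := by
    calc ‖𝒢 (W (X + 𝔄))‖ ≤ B₀ * ‖W (X + 𝔄)‖ := h𝒢 _
      _ ≤ B₀ * (C₄ * ‖X + 𝔄‖ ^ 2) := mul_le_mul_of_nonneg_left (hW.quad _ harg) hB₀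
      _ = B₀ * C₄ * ‖X + 𝔄‖ ^ 2 := by ring
  have h4 : ‖X + 𝔄‖ ^ 2 ≤ (‖X‖ + ‖𝔄‖) ^ 2 :=
    pow_le_pow_left₀ (norm_nonneg _) (norm_add_le _ _) 2
  have h5 : B₀ * C₄ * ‖X + 𝔄‖ ^ 2 ≤ B₀ * C₄ * (‖X‖ + ‖𝔄‖) ^ 2 :=
    mul_le_mul_of_nonneg_left h4 (mul_nonneg hB₀ hC₄)
  calc ‖X‖ = ‖mapT 𝒢 0 W J 𝔄 X‖ := by rw [hfix]
    _ = ‖-𝒢 J - 𝒢 (W (X + 𝔄))‖ := by rw [mapT_noLinear]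
    _ ≤ ‖-𝒢 J‖ + ‖𝒢 (W (X + 𝔄))‖ := norm_sub_le _ _
    _ = ‖𝒢 J‖ + ‖𝒢 (W (X + 𝔄))‖ := by rw [norm_neg]
    _ ≤ ‖𝒢 J‖ + B₀ * C₄ * (‖X‖ + ‖𝔄‖) ^ 2 := by linarith

/-- **R1^ϱ, (S1)–(S3) form** (`T4R1Response.apriori_response` applied to `ineq117_at_fixedPoint`): in the ball
‖X‖ ≤ ε₄ with ‖X + 𝔄‖ < a₃ and the (121)-shape smallness 8B₀C₄(ε₄ + ‖𝔄‖) ≤ 1: `7‖X‖ ≤ 8‖𝒢 J‖ + ‖𝔄‖`.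
[folklore] -/
theorem seven_norm_solution_le (h𝒢 : ∀ f, ‖𝒢 f‖ ≤ B₀ * ‖f‖) (hW : QuadAnalytic W C₄ a₃) (hB₀ : 0 ≤ B₀)
    (hC₄ : 0 ≤ C₄) {J : 𝒵} {𝔄 X : 𝒴} {ε₄ : ℝ} (hX : ‖X‖ ≤ ε₄) (harg : ‖X + 𝔄‖ < a₃)
    (hfix : mapT 𝒢 0 W J 𝔄 X = X) (h121 : 8 * (B₀ * C₄ * (ε₄ + ‖𝔄‖)) ≤ 1) :
    7 * ‖X‖ ≤ 8 * ‖𝒢 J‖ + ‖𝔄‖ :=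
  T4R1Response.apriori_response (mul_nonneg hB₀ hC₄) (norm_nonneg X) (norm_nonneg 𝔄) hX
    (ineq117_at_fixedPoint h𝒢 hW hB₀ hC₄ harg hfix) h121

/-! ## §4 Two data, one background: the Lipschitz response in (J, 𝔄) (NOT printed — T4-XREAD-U1b-L3 §3 (i)) -/

/-- The defect between the maps with data (J₁, 𝔄₁) and (J₂, 𝔄₂) at a common point (algebra). [folklore] -/
theorem mapT_sub_mapT_data (𝒢 : 𝒵 →L[ℂ] 𝒴) (Λ : 𝒴 →L[ℂ] 𝒴) (W : 𝒴 → 𝒵) (J₁ J₂ : 𝒵) (𝔄₁ 𝔄₂ X : 𝒴) :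
    mapT 𝒢 Λ W J₁ 𝔄₁ X - mapT 𝒢 Λ W J₂ 𝔄₂ X =
      -𝒢 (J₁ - J₂) + Λ (𝔄₁ - 𝔄₂) - 𝒢 (W (X + 𝔄₁) - W (X + 𝔄₂)) := by
  simp only [mapT, map_sub, map_add]
  abel

/-- Norm of the two-data defect in the ball: `‖T₁ X − T₂ X‖ ≤ ‖𝒢(J₁ − J₂)‖ + (θ + 4B₀C₄(ε₄ + a))‖𝔄₁ − 𝔄₂‖`
(§2 applied to P_i = X + 𝔄_i, both of norm < ε₄ + a). [folklore] -/
theorem norm_defect_data_le (h𝒢 : ∀ f, ‖𝒢 f‖ ≤ B₀ * ‖f‖) (hΛ : ∀ Y, ‖Λ Y‖ ≤ θ * ‖Y‖)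
    (hW : QuadAnalytic W C₄ a₃) (hB₀ : 0 ≤ B₀) (hC₄ : 0 ≤ C₄) {J₁ J₂ : 𝒵} {𝔄₁ 𝔄₂ X : 𝒴} {a ε₄ : ℝ}
    (h𝔄₁ : ‖𝔄₁‖ < a) (h𝔄₂ : ‖𝔄₂‖ < a) (hX : ‖X‖ ≤ ε₄) (hdom : 2 * (ε₄ + a) ≤ a₃) :
    ‖mapT 𝒢 Λ W J₁ 𝔄₁ X - mapT 𝒢 Λ W J₂ 𝔄₂ X‖ ≤
      ‖𝒢 (J₁ - J₂)‖ + (θ + 4 * B₀ * C₄ * (ε₄ + a)) * ‖𝔄₁ - 𝔄₂‖ := by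
  have hP₁ : ‖X + 𝔄₁‖ < ε₄ + a := norm_arg_lt h𝔄₁ hX
  have hP₂ : ‖X + 𝔄₂‖ < ε₄ + a := norm_arg_lt h𝔄₂ hX
  have hWd : ‖W (X + 𝔄₁) - W (X + 𝔄₂)‖ ≤ 4 * C₄ * (ε₄ + a) * ‖𝔄₁ - 𝔄₂‖ := by
    have h := quadAnalytic_norm_sub_le hW hC₄ hdom hP₁ hP₂
    have e : X + 𝔄₁ - (X + 𝔄₂) = 𝔄₁ - 𝔄₂ := by abel
    rwa [e] at h
  rw [mapT_sub_mapT_data]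
  have t1 : ‖-𝒢 (J₁ - J₂)‖ = ‖𝒢 (J₁ - J₂)‖ := norm_neg _
  have t2 : ‖Λ (𝔄₁ - 𝔄₂)‖ ≤ θ * ‖𝔄₁ - 𝔄₂‖ := hΛ _
  have t3 : ‖𝒢 (W (X + 𝔄₁) - W (X + 𝔄₂))‖ ≤ B₀ * (4 * C₄ * (ε₄ + a) * ‖𝔄₁ - 𝔄₂‖) :=
    (h𝒢 _).trans (mul_le_mul_of_nonneg_left hWd hB₀)
  calc ‖-𝒢 (J₁ - J₂) + Λ (𝔄₁ - 𝔄₂) - 𝒢 (W (X + 𝔄₁) - W (X + 𝔄₂))‖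
      ≤ ‖-𝒢 (J₁ - J₂) + Λ (𝔄₁ - 𝔄₂)‖ + ‖𝒢 (W (X + 𝔄₁) - W (X + 𝔄₂))‖ := norm_sub_le _ _
    _ ≤ (‖-𝒢 (J₁ - J₂)‖ + ‖Λ (𝔄₁ - 𝔄₂)‖) + ‖𝒢 (W (X + 𝔄₁) - W (X + 𝔄₂))‖ := by
        gcongr; exact norm_add_le _ _
    _ ≤ ‖𝒢 (J₁ - J₂)‖ + θ * ‖𝔄₁ - 𝔄₂‖ + B₀ * (4 * C₄ * (ε₄ + a) * ‖𝔄₁ - 𝔄₂‖) := by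
        rw [t1]; linarith
    _ = ‖𝒢 (J₁ - J₂)‖ + (θ + 4 * B₀ * C₄ * (ε₄ + a)) * ‖𝔄₁ - 𝔄₂‖ := by ring

/-- **Two-data Lipschitz response** (NOT PRINTED; T4-XREAD-U1b-L3 §3 (i) asked for it): for one background
(𝒢, Λ, W) and two data (J₁, 𝔄₁), (J₂, 𝔄₂) with ‖𝔄_i‖ < a, the fixed points X₁, X₂ in the ball ‖X‖ ≤ ε₄ satisfy
`‖X₁ − X₂‖ ≤ (‖𝒢(J₁ − J₂)‖ + q‖𝔄₁ − 𝔄₂‖) / (1 − q)`, q = θ + 4B₀C₄(ε₄ + a) < 1.  [folklore] -/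
theorem norm_solution_sub_le_data (h𝒢 : ∀ f, ‖𝒢 f‖ ≤ B₀ * ‖f‖) (hΛ : ∀ Y, ‖Λ Y‖ ≤ θ * ‖Y‖)
    (hW : QuadAnalytic W C₄ a₃) (hB₀ : 0 ≤ B₀) (hC₄ : 0 ≤ C₄) {J₁ J₂ : 𝒵} {𝔄₁ 𝔄₂ : 𝒴} {a ε₄ : ℝ}
    (h𝔄₁ : ‖𝔄₁‖ < a) (h𝔄₂ : ‖𝔄₂‖ < a) (hε₄ : 0 ≤ ε₄) (hdom : 2 * (ε₄ + a) ≤ a₃)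
    (hcontr : θ + 4 * B₀ * C₄ * (ε₄ + a) < 1) {X₁ X₂ : 𝒴} (h₁ : ‖X₁‖ ≤ ε₄) (h₂ : ‖X₂‖ ≤ ε₄)
    (f₁ : mapT 𝒢 Λ W J₁ 𝔄₁ X₁ = X₁) (f₂ : mapT 𝒢 Λ W J₂ 𝔄₂ X₂ = X₂) :
    ‖X₁ - X₂‖ ≤ (‖𝒢 (J₁ - J₂)‖ + (θ + 4 * B₀ * C₄ * (ε₄ + a)) * ‖𝔄₁ - 𝔄₂‖) /
      (1 - (θ + 4 * B₀ * C₄ * (ε₄ + a))) := by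
  have h := norm_sub_le_of_fixedPoints (T₂ := mapT 𝒢 Λ W J₂ 𝔄₂) hcontr
    (fun _ _ hx hy => lipschitz_120 (J := J₁) h𝒢 hΛ hW hB₀ hC₄ h𝔄₁ hε₄ hdom hx hy) h₁ h₂ f₁ f₂
  have hd := norm_defect_data_le (J₁ := J₁) (J₂ := J₂) h𝒢 hΛ hW hB₀ hC₄ h𝔄₁ h𝔄₂ h₂ hdom
  have h1q : 0 < 1 - (θ + 4 * B₀ * C₄ * (ε₄ + a)) := by linarith
  exact h.trans (div_le_div_of_nonneg_right hd h1q.le)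

/-! ## §5 Two backgrounds: the Lipschitz response in (𝒢, Λ, W) (NOT printed) -/

/-- The defect between the maps of two backgrounds at a common point and common data (algebra): the
propagator difference acts on J and on W₂(X + 𝔄), the functional difference W₁ − W₂ is evaluated AT the point.
[folklore] -/
theorem mapT_sub_mapT_background (𝒢₁ 𝒢₂ : 𝒵 →L[ℂ] 𝒴) (Λ₁ Λ₂ : 𝒴 →L[ℂ] 𝒴) (W₁ W₂ : 𝒴 → 𝒵) (J : 𝒵)
    (𝔄 X : 𝒴) :
    mapT 𝒢₁ Λ₁ W₁ J 𝔄 X - mapT 𝒢₂ Λ₂ W₂ J 𝔄 X =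
      -(𝒢₁ - 𝒢₂) J + (Λ₁ - Λ₂) (X + 𝔄) - (𝒢₁ - 𝒢₂) (W₂ (X + 𝔄)) - 𝒢₁ (W₁ (X + 𝔄) - W₂ (X + 𝔄)) := by
  simp only [mapT, sub_apply, map_sub]
  abel

/-- **General response** (two backgrounds AND two data): the fixed points X₁ of T₁ = `mapT 𝒢₁ Λ₁ W₁ J₁ 𝔄₁` and
X₂ of T₂ = `mapT 𝒢₂ Λ₂ W₂ J₂ 𝔄₂` in the ball ‖X‖ ≤ ε₄ satisfy `‖X₁ − X₂‖ ≤ ‖T₁ X₂ − T₂ X₂‖ / (1 − q₁)` with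
T₁'s contraction constant q₁ = θ + 4B₀C₄(ε₄ + a) ((120), for ‖𝔄₁‖ < a, 2(ε₄ + a) ≤ a₃); only T₁ needs to be a
contraction. [folklore] -/
theorem norm_solution_sub_le_general {𝒢₁ 𝒢₂ : 𝒵 →L[ℂ] 𝒴} {Λ₁ Λ₂ : 𝒴 →L[ℂ] 𝒴} {W₁ W₂ : 𝒴 → 𝒵}
    (h𝒢₁ : ∀ f, ‖𝒢₁ f‖ ≤ B₀ * ‖f‖) (hΛ₁ : ∀ Y, ‖Λ₁ Y‖ ≤ θ * ‖Y‖) (hW₁ : QuadAnalytic W₁ C₄ a₃)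
    (hB₀ : 0 ≤ B₀) (hC₄ : 0 ≤ C₄) {J₁ J₂ : 𝒵} {𝔄₁ 𝔄₂ : 𝒴} {a ε₄ : ℝ} (h𝔄₁ : ‖𝔄₁‖ < a)
    (hε₄ : 0 ≤ ε₄) (hdom : 2 * (ε₄ + a) ≤ a₃) (hcontr : θ + 4 * B₀ * C₄ * (ε₄ + a) < 1)
    {X₁ X₂ : 𝒴} (h₁ : ‖X₁‖ ≤ ε₄) (h₂ : ‖X₂‖ ≤ ε₄) (f₁ : mapT 𝒢₁ Λ₁ W₁ J₁ 𝔄₁ X₁ = X₁)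
    (f₂ : mapT 𝒢₂ Λ₂ W₂ J₂ 𝔄₂ X₂ = X₂) :
    ‖X₁ - X₂‖ ≤ ‖mapT 𝒢₁ Λ₁ W₁ J₁ 𝔄₁ X₂ - mapT 𝒢₂ Λ₂ W₂ J₂ 𝔄₂ X₂‖ /
      (1 - (θ + 4 * B₀ * C₄ * (ε₄ + a))) :=
  norm_sub_le_of_fixedPoints (T₂ := mapT 𝒢₂ Λ₂ W₂ J₂ 𝔄₂) hcontr
    (fun _ _ hx hy => lipschitz_120 (J := J₁) h𝒢₁ hΛ₁ hW₁ hB₀ hC₄ h𝔄₁ hε₄ hdom hx hy) h₁ h₂ f₁ f₂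

/-- **Two-background Lipschitz response** (the payload's "Lipschitz response of the fixed point in the
background data"; NOT PRINTED): common data (J, 𝔄), backgrounds (𝒢₁, Λ₁, W₁) [a contraction] and (𝒢₂, Λ₂, W₂)
[arbitrary]: `‖X₁ − X₂‖ ≤ (‖(𝒢₁ − 𝒢₂)J‖ + ‖(Λ₁ − Λ₂)(X₂ + 𝔄)‖ + ‖(𝒢₁ − 𝒢₂)(W₂(X₂ + 𝔄))‖ +
B₀‖W₁(X₂ + 𝔄) − W₂(X₂ + 𝔄)‖) / (1 − q₁)` — every term evaluated AT the second solution, whose argument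
X₂ + 𝔄 has norm < ε₄ + a. [folklore] -/
theorem norm_solution_sub_le_background {𝒢₁ 𝒢₂ : 𝒵 →L[ℂ] 𝒴} {Λ₁ Λ₂ : 𝒴 →L[ℂ] 𝒴} {W₁ W₂ : 𝒴 → 𝒵}
    (h𝒢₁ : ∀ f, ‖𝒢₁ f‖ ≤ B₀ * ‖f‖) (hΛ₁ : ∀ Y, ‖Λ₁ Y‖ ≤ θ * ‖Y‖) (hW₁ : QuadAnalytic W₁ C₄ a₃)
    (hB₀ : 0 ≤ B₀) (hC₄ : 0 ≤ C₄) {J : 𝒵} {𝔄 : 𝒴} {a ε₄ : ℝ} (h𝔄 : ‖𝔄‖ < a) (hε₄ : 0 ≤ ε₄)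
    (hdom : 2 * (ε₄ + a) ≤ a₃) (hcontr : θ + 4 * B₀ * C₄ * (ε₄ + a) < 1) {X₁ X₂ : 𝒴}
    (h₁ : ‖X₁‖ ≤ ε₄) (h₂ : ‖X₂‖ ≤ ε₄) (f₁ : mapT 𝒢₁ Λ₁ W₁ J 𝔄 X₁ = X₁)
    (f₂ : mapT 𝒢₂ Λ₂ W₂ J 𝔄 X₂ = X₂) :
    ‖X₁ - X₂‖ ≤ (‖(𝒢₁ - 𝒢₂) J‖ + ‖(Λ₁ - Λ₂) (X₂ + 𝔄)‖ + ‖(𝒢₁ - 𝒢₂) (W₂ (X₂ + 𝔄))‖ +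
        B₀ * ‖W₁ (X₂ + 𝔄) - W₂ (X₂ + 𝔄)‖) / (1 - (θ + 4 * B₀ * C₄ * (ε₄ + a))) := by
  have h := norm_solution_sub_le_general (J₂ := J) (𝔄₂ := 𝔄) h𝒢₁ hΛ₁ hW₁ hB₀ hC₄ h𝔄 hε₄ hdom hcontr
    h₁ h₂ f₁ f₂
  have h1q : 0 < 1 - (θ + 4 * B₀ * C₄ * (ε₄ + a)) := by linarith
  refine h.trans (div_le_div_of_nonneg_right ?_ h1q.le)
  rw [mapT_sub_mapT_background]
  have t4 : ‖𝒢₁ (W₁ (X₂ + 𝔄) - W₂ (X₂ + 𝔄))‖ ≤ B₀ * ‖W₁ (X₂ + 𝔄) - W₂ (X₂ + 𝔄)‖ := h𝒢₁ _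
  calc ‖-(𝒢₁ - 𝒢₂) J + (Λ₁ - Λ₂) (X₂ + 𝔄) - (𝒢₁ - 𝒢₂) (W₂ (X₂ + 𝔄)) -
        𝒢₁ (W₁ (X₂ + 𝔄) - W₂ (X₂ + 𝔄))‖
      ≤ ‖-(𝒢₁ - 𝒢₂) J + (Λ₁ - Λ₂) (X₂ + 𝔄) - (𝒢₁ - 𝒢₂) (W₂ (X₂ + 𝔄))‖ +
        ‖𝒢₁ (W₁ (X₂ + 𝔄) - W₂ (X₂ + 𝔄))‖ := norm_sub_le _ _
    _ ≤ (‖-(𝒢₁ - 𝒢₂) J + (Λ₁ - Λ₂) (X₂ + 𝔄)‖ + ‖(𝒢₁ - 𝒢₂) (W₂ (X₂ + 𝔄))‖) +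
        ‖𝒢₁ (W₁ (X₂ + 𝔄) - W₂ (X₂ + 𝔄))‖ := by gcongr; exact norm_sub_le _ _
    _ ≤ ((‖-(𝒢₁ - 𝒢₂) J‖ + ‖(Λ₁ - Λ₂) (X₂ + 𝔄)‖) + ‖(𝒢₁ - 𝒢₂) (W₂ (X₂ + 𝔄))‖) +
        ‖𝒢₁ (W₁ (X₂ + 𝔄) - W₂ (X₂ + 𝔄))‖ := by gcongr; exact norm_add_le _ _
    _ ≤ ‖(𝒢₁ - 𝒢₂) J‖ + ‖(Λ₁ - Λ₂) (X₂ + 𝔄)‖ + ‖(𝒢₁ - 𝒢₂) (W₂ (X₂ + 𝔄))‖ +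
        B₀ * ‖W₁ (X₂ + 𝔄) - W₂ (X₂ + 𝔄)‖ := by rw [norm_neg]; linarith

/-! ## §6 The nesting identity behind the cross-scale pairing (order theory; [folklore]) -/

section Nesting

variable {F C D : Type*}

/-- The ONE-STEP EFFECTIVE ACTION of a fine action `A` on the admissible set `S` under the one-step average `Q₁`:
`effAction S Q₁ A V₀ = inf {A U : U ∈ S, Q₁ U = V₀}` (intended: V₀ a configuration on T_η, U on T_{η/L}, Q₁ the
one-step block average of [Balaban1985Averaging], A = A^{η/L} of (5) p. 278, S = the small-field conditions (2)
on the fine configuration; then `effAction` is the classical part of one renormalisation step).  `sInf` on ℝ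
(junk value 0 on an empty or unbounded fibre — the theorems below only use fibres that are non-empty and bounded
below). [folklore] -/
noncomputable def effAction (S : Set F) (Q₁ : F → C) (A : F → ℝ) (V₀ : C) : ℝ :=
  sInf (A '' {U | U ∈ S ∧ Q₁ U = V₀})

/-- **Nesting, value half.**  If `U⋆ ∈ S` minimises `A` over the (k+1)-fold constraint `Q_k (Q₁ U) = V` within
`S`, then the effective action of its own one-step average is its action: `effAction S Q₁ A (Q₁ U⋆) = A U⋆`.
[folklore] -/
theorem effAction_avg_eq {S : Set F} {Q₁ : F → C} {Qk : C → D} {A : F → ℝ} {V : D} {Us : F}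
    (hS : Us ∈ S) (hV : Qk (Q₁ Us) = V) (hmin : ∀ U ∈ S, Qk (Q₁ U) = V → A Us ≤ A U) :
    effAction S Q₁ A (Q₁ Us) = A Us := by
  unfold effAction
  have hmem : A Us ∈ A '' {U | U ∈ S ∧ Q₁ U = Q₁ Us} := ⟨Us, ⟨hS, rfl⟩, rfl⟩
  have hlb : ∀ b ∈ A '' {U | U ∈ S ∧ Q₁ U = Q₁ Us}, A Us ≤ b := by
    rintro b ⟨U, ⟨hU, hQ⟩, rfl⟩
    exact hmin U hU (by rw [hQ, hV])
  exact le_antisymm (csInf_le ⟨A Us, hlb⟩ hmem) (le_csInf ⟨A Us, hmem⟩ hlb)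

/-- **Nesting, minimality half.**  Under the same hypotheses the one-step average `Q₁ U⋆` MINIMISES the one-step
effective action over the k-fold constraint among averages of admissible fine configurations:
`effAction S Q₁ A (Q₁ U⋆) ≤ effAction S Q₁ A V₀` for every `V₀ ∈ Q₁ '' S` with `Q_k V₀ = V`.  (Dictionary: the
one-block average W_k(V) of the (k+1)-step minimiser U_{k+1}^{(η/L)}(V) is the minimiser of the ONE-STEP
EFFECTIVE action under the k-step constraint, on the same lattice T_η on which U_k^{(η)}(V) minimises the BARE
action (5) under the same constraint — the pairing of HOME/t4/T4-EST-U1b.md §1.2 recast; see §7.) [folklore] -/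
theorem effAction_avg_le {S : Set F} {Q₁ : F → C} {Qk : C → D} {A : F → ℝ} {V : D} {Us : F}
    (hS : Us ∈ S) (hV : Qk (Q₁ Us) = V) (hmin : ∀ U ∈ S, Qk (Q₁ U) = V → A Us ≤ A U)
    {V₀ : C} (hV₀ : V₀ ∈ Q₁ '' S) (hQV₀ : Qk V₀ = V) :
    effAction S Q₁ A (Q₁ Us) ≤ effAction S Q₁ A V₀ := by
  rw [effAction_avg_eq hS hV hmin]
  obtain ⟨U', hU'S, hU'Q⟩ := hV₀
  have hne : (A '' {U | U ∈ S ∧ Q₁ U = V₀}).Nonempty := ⟨A U', U', ⟨hU'S, hU'Q⟩, rfl⟩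
  refine le_csInf hne ?_
  rintro b ⟨U, ⟨hU, hQ⟩, rfl⟩
  exact hmin U hU (by rw [hQ, hQV₀])

/-- **Nesting, fibre half.**  `U⋆` also minimises `A` in its own one-step fibre `{U ∈ S : Q₁ U = Q₁ U⋆}` — it IS
the one-step minimiser with datum `Q₁ U⋆` (so U_{k+1}(V) = U₁(W_k(V)) in the dictionary, uniqueness aside).
[folklore] -/
theorem min_in_fibre {S : Set F} {Q₁ : F → C} {Qk : C → D} {A : F → ℝ} {V : D} {Us : F}
    (hV : Qk (Q₁ Us) = V) (hmin : ∀ U ∈ S, Qk (Q₁ U) = V → A Us ≤ A U)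
    {U : F} (hU : U ∈ S) (hQ : Q₁ U = Q₁ Us) : A Us ≤ A U :=
  hmin U hU (by rw [hQ, hV])

end Nesting

/-! ## §7 The propagated residual of the averaged finer minimiser IS the propagated derivative of the one-step
classical correction (linear algebra of the first-order conditions; the typed form of the re-cut R2^ϱ ⇐ OSC) -/

/-- **First-order transfer.**  Abstract form of: W is critical for the one-step EFFECTIVE action under the k-fold
constraint (`𝔓 Jeff = 0`, 𝔓 = the projection onto constraint-and-gauge-admissible variations), the bare current
splits as `J = Jeff − Jδ` (Jδ = the variational derivative AT W of the one-step classical correction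
δA = effective − bare), and the constrained propagator only sees admissible components (`𝒢 ∘ 𝔓 = 𝒢`, the
printed-type property of 𝔊 of [Balaban1985Propagators] Thm 3.13 as a HYPOTHESIS): then `𝒢 J = −𝒢 Jδ`, i.e. the
propagated residual ϱ = ‖𝔊J‖ of R1^ϱ equals ‖𝔊 Jδ‖.  Nothing printed is asserted; ENV (differentiability of
the effective action at W, interior minimum) and PROJ are named hypotheses of the record HOME/t4/T4-EST-NE3-P1.md.
[folklore] -/
theorem propagated_residual_eq (𝒢 : 𝒵 →L[ℂ] 𝒴) (𝔓 : 𝒵 →L[ℂ] 𝒵) (hproj : ∀ f, 𝒢 (𝔓 f) = 𝒢 f)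
    {J Jeff Jδ : 𝒵} (hsplit : J = Jeff - Jδ) (hcrit : 𝔓 Jeff = 0) : 𝒢 J = -𝒢 Jδ := by
  rw [← hproj J, hsplit, map_sub, hcrit, zero_sub, map_neg, hproj]

/-- Hence the norm identity `‖𝒢 J‖ = ‖𝒢 Jδ‖` (ϱ_k(V) = osc_k(V) in the record's notation). [folklore] -/
theorem norm_propagated_residual_eq (𝒢 : 𝒵 →L[ℂ] 𝒴) (𝔓 : 𝒵 →L[ℂ] 𝒵) (hproj : ∀ f, 𝒢 (𝔓 f) = 𝒢 f)
    {J Jeff Jδ : 𝒵} (hsplit : J = Jeff - Jδ) (hcrit : 𝔓 Jeff = 0) : ‖𝒢 J‖ = ‖𝒢 Jδ‖ := by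
  rw [propagated_residual_eq 𝒢 𝔓 hproj hsplit hcrit, norm_neg]

/-- **R1^ϱ ∘ §7 at one instance**: a fixed point X of (116) with exact constraints (𝔄 = 0) around a background
whose bare current splits as above obeys `‖X‖ ≤ 2‖𝒢 Jδ‖` — the minimiser's response is at most twice the
propagated derivative of the one-step classical correction. [folklore] -/
theorem norm_solution_le_two_oneStep (h𝒢 : ∀ f, ‖𝒢 f‖ ≤ B₀ * ‖f‖) (hW : QuadAnalytic W C₄ a₃)
    (hB₀ : 0 ≤ B₀) (hC₄ : 0 ≤ C₄) (𝔓 : 𝒵 →L[ℂ] 𝒵) (hproj : ∀ f, 𝒢 (𝔓 f) = 𝒢 f) {J Jeff Jδ : 𝒵}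
    (hsplit : J = Jeff - Jδ) (hcrit : 𝔓 Jeff = 0) {a ε₄ : ℝ} (ha : 0 < a) (hε₄ : 0 ≤ ε₄)
    (hdom : 2 * (ε₄ + a) ≤ a₃) (hhalf : 4 * B₀ * C₄ * (ε₄ + a) ≤ 1 / 2) {X : 𝒴} (hX : ‖X‖ ≤ ε₄)
    (hfix : mapT 𝒢 0 W J 0 X = X) : ‖X‖ ≤ 2 * ‖𝒢 Jδ‖ := by
  rw [← norm_propagated_residual_eq 𝒢 𝔓 hproj hsplit hcrit]
  exact norm_solution_le_two_exact h𝒢 hW hB₀ hC₄ ha hε₄ hdom hhalf hX hfix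

/-! ## §8 Assembly into NE3's bookkeeping (`T4EtaRateMin`): every non-printed input a named binder -/

open Literature.MathematicalPhysics.QuantumFieldTheory.Balaban1983to89.T4EtaRateMin (Readings LocalRate)

/-- **NE3 (local readings) from the one-step re-cut.**  Per run index k and admissible datum V let `nrm k V` be
the (115)-norm of the response field (U_k(V) written around the averaged finer minimiser W_k(V)), `osc k V` the
propagated derivative of the one-step classical correction at W_k(V) (§7), `pair k V` the pairing defect of the
readings (finer minimiser versus its own one-block average, HOME/t4/T4-EST-U1b.md §1.2 (P1)–(P3)).  HYPOTHESES,
all named and none printed as such: `hread` (the local reading is Λr-Lipschitz in the response field, plus the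
pairing defect — R3-type), `hresp` (R0 ∧ R1^ϱ ∧ ENV ∧ PROJ per instance: `nrm ≤ Γ·osc`, Γ = 2 by
`norm_solution_le_two_oneStep` once the instance realises the scheme), `hosc` (OSC — the one-step classical
correction estimate, NOT PRINTED, the wall of the record), `hpair` (pairing rate).  CONCLUSION:
`LocalRate R (Λr·Γ·ρ₁ + ρ₂) θ`.  None of BetaPertH, (B), (B^μ) occurs: NE3 is a statement about minimisers only
(T4-DAG §3). [folklore] -/
theorem localRate_of_oneStep {ι X : Type*} {R : Readings ι X} {Γ Λr ρ₁ ρ₂ θ : ℝ}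
    (nrm osc pair : ℕ → ι → ℝ) (hΓ : 0 ≤ Γ) (hΛr : 0 ≤ Λr)
    (hread : ∀ k : ℕ, ∀ V ∈ R.dom, ∀ x : X,
      |R.loc (k + 1) V x - R.loc k V x| ≤ Λr * nrm k V + pair k V)
    (hresp : ∀ k : ℕ, ∀ V ∈ R.dom, nrm k V ≤ Γ * osc k V)
    (hosc : ∀ k : ℕ, ∀ V ∈ R.dom, osc k V ≤ ρ₁ * θ ^ k)
    (hpair : ∀ k : ℕ, ∀ V ∈ R.dom, pair k V ≤ ρ₂ * θ ^ k) :
    LocalRate R (Λr * Γ * ρ₁ + ρ₂) θ := by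
  intro k V hV x
  have e1 : Λr * nrm k V ≤ Λr * (Γ * (ρ₁ * θ ^ k)) :=
    mul_le_mul_of_nonneg_left ((hresp k V hV).trans (mul_le_mul_of_nonneg_left (hosc k V hV) hΓ)) hΛr
  calc |R.loc (k + 1) V x - R.loc k V x| ≤ Λr * nrm k V + pair k V := hread k V hV x
    _ ≤ Λr * (Γ * (ρ₁ * θ ^ k)) + ρ₂ * θ ^ k := add_le_add e1 (hpair k V hV)
    _ = (Λr * Γ * ρ₁ + ρ₂) * θ ^ k := by ring

/-- **OSC, the shape of the wall.**  `OneStepCorrectionRate dom osc ρ θ := ∀ k, ∀ V ∈ dom, osc k V ≤ ρ·θ^k`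
(intended reading, record §4: osc k V = ‖𝔊(W_k(V)) 𝔓 D(δA_k)(W_k(V))‖_(115), the propagated derivative at the averaged
finer minimiser of the one-step classical correction δA_k = effAction − A^η; NOT PRINTED; predicted θ = L^{−1}).
A predicate, never used as a fact. [folklore] -/
def OneStepCorrectionRate {ι : Type*} (dom : Set ι) (osc : ℕ → ι → ℝ) (ρ θ : ℝ) : Prop :=
  ∀ k : ℕ, ∀ V ∈ dom, osc k V ≤ ρ * θ ^ k

/-- `localRate_of_oneStep` with the wall named: OSC (`OneStepCorrectionRate`) + response + reading + pairing ⇒ NE3's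
`LocalRate`. [folklore] -/
theorem localRate_of_oneStep' {ι X : Type*} {R : Readings ι X} {Γ Λr ρ₁ ρ₂ θ : ℝ}
    (nrm osc pair : ℕ → ι → ℝ) (hΓ : 0 ≤ Γ) (hΛr : 0 ≤ Λr)
    (hread : ∀ k : ℕ, ∀ V ∈ R.dom, ∀ x : X,
      |R.loc (k + 1) V x - R.loc k V x| ≤ Λr * nrm k V + pair k V)
    (hresp : ∀ k : ℕ, ∀ V ∈ R.dom, nrm k V ≤ Γ * osc k V)
    (hosc : OneStepCorrectionRate R.dom osc ρ₁ θ)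
    (hpair : OneStepCorrectionRate R.dom pair ρ₂ θ) :
    LocalRate R (Λr * Γ * ρ₁ + ρ₂) θ :=
  localRate_of_oneStep nrm osc pair hΓ hΛr hread hresp hosc hpair

/-- The wall is NOT vacuous as a shape: a geometric sequence satisfies it (θ = 1/2, ρ = 1), and the zero sequence
satisfies it for every ρ ≥ 0. [folklore] -/
example : OneStepCorrectionRate (Set.univ : Set Unit) (fun k _ => (1 / 2 : ℝ) ^ k) 1 (1 / 2) := by
  intro k V _; simp

/-! ## §9 Non-vacuity (numerical and finite-dimensional instances) -/

/-- The perturbation lemma is sharp on ℝ: T₁ x = x/2 + 1 (fixed point 2, q = ½), T₂ x = x/2 (fixed point 0):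
‖2 − 0‖ = 2 = ‖T₁ 0 − T₂ 0‖/(1 − ½) = 1/(1/2). -/
example : ‖(2 : ℝ) - 0‖ ≤ ‖((0 : ℝ) / 2 + 1) - (0 : ℝ) / 2‖ / (1 - 1 / 2) := by norm_num

/-- `norm_sub_le_of_fixedPoints` applies to this pair (r = 2). -/
example : ‖(2 : ℝ) - 0‖ ≤ ‖((fun x : ℝ => x / 2 + 1) 0 - (fun x : ℝ => x / 2) 0)‖ / (1 - 1 / 2) :=
  norm_sub_le_of_fixedPoints (T₁ := fun x : ℝ => x / 2 + 1) (T₂ := fun x : ℝ => x / 2) (r := 2)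
    (by norm_num)
    (fun x y _ _ => by
      show ‖(x / 2 + 1) - (y / 2 + 1)‖ ≤ 1 / 2 * ‖x - y‖
      rw [show (x / 2 + 1) - (y / 2 + 1) = (1 / 2 : ℝ) * (x - y) by ring, norm_mul]
      norm_num)
    (by norm_num) (by norm_num) (by norm_num) (by norm_num)

/-- The nesting lemmas are non-vacuous: fine configurations ℝ × ℝ, one-step average = first coordinate, k-fold
constraint trivial, action (u − 1)² + v²; the minimiser (1, 0) has average 1 and `effAction = 0` there. -/
example : effAction (Set.univ : Set (ℝ × ℝ)) Prod.fst (fun U => (U.1 - 1) ^ 2 + U.2 ^ 2) ((1, 0) : ℝ × ℝ).1 =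
    (fun U : ℝ × ℝ => (U.1 - 1) ^ 2 + U.2 ^ 2) (1, 0) :=
  effAction_avg_eq (Qk := fun _ : ℝ => (0 : Unit)) (V := (0 : Unit)) (Set.mem_univ _) rfl
    (fun U _ _ => by dsimp only; nlinarith [sq_nonneg (U.1 - 1), sq_nonneg U.2])

end Literature.MathematicalPhysics.QuantumFieldTheory.Balaban1983to89.T4FixedPointResponse
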